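import Summits.RiemannHypothesis.RiemannHypothesis.Theorems.GroundBartaPolarPerronFrobeniusEvenSectorNegativity
import Summits.RiemannHypothesis.RiemannHypothesis.Theorems.WeilGroundStateGroundStatesConvergeToXiGapQuasimode
import Summits.RiemannHypothesis.RiemannHypothesis.Theorems.WeilGroundStateGroundStatesConvergeToXiEnergySubexp
import HarnessLib

/-!
# PfPersistence (M2 seat) — the variational-ratio route to M2 is a thermometer

Bundle `papers/RiemannHypothesis/pf-persistence/` (cell `pub-rhpf`, seat M2), file `M2-ROUTE.md`.
HONEST FRAMING: long-odds MECHANISM SEARCH; no RH claims. Everything below is RH-free and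
kernel-checked; every appearance of a lower bound on a ground energy is an explicit HYPOTHESIS.

Setting (tree vocabulary, additive window `[-a, a]`, `λ = eᵃ`, `μ = λ² = e^{2a}`):
`ε(a) = weilGroundEnergy a` (bottom of Weil's truncated form), `ε_ev(a) = weilEvenGroundEnergy a`,
`Q = weilQuadratic`.  Connes–Consani–Moscovici's missing Step 2 (`ConnesConsaniMoscovici2025` §§7–8;
`Connes2026Letter` §7.4) asks that the ground state `u` be close to the prolate guess `k_λ`.  The
"M2 of variational ratio" mechanism is the Temple / gap–angle inequality, IN THE TREE:
abstractly `soloBlind_temple_dist_of_ground` (`SoloBlindTempleGap.lean`), concretely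
`GroundStatesConvergeToXi.one_sub_norm_sq_overlap_le_of_gap` (`…GapQuasimode.lean`): a variational
gap inequality with constant `δ` in the direction of `u` plus a normalised window test `p` with
`Re Q(p) ≤ ε(a) + θδ` gives `1 − |⟨p,u⟩|² ≤ θ`; `θ = (Re Q(p) − ε(a))/δ` is the M2 RATIO.

What this file adds (all [folklore]-grade real analysis on top of tree theorems):

* §1 the real arithmetic of the ratio: `ratio_le_of_upper_floor_gap` (upper half `R ≤ U`, floor
  `−σ ≤ ε₁`, gap `G ≤ ε₂ − ε₁` ⇒ ratio `≤ (U + σ)/G`); `neg_le_of_ratio_le` (CONVERSELY a ratio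
  bound `θ < 1` together with the two a-priori side bounds `ε₂ ≤ B`, `−U ≤ R` FORCES the floor
  `−ε₁ ≤ (θB + U)/(1 − θ)`); `ratio_le_of_nonneg_floor` / `ratio_le_inv_of_dominance` (under a
  non-negative floor the ratio is `≤ R/(ε₂ − R) ≤ 1/(m − 1)` as soon as `ε₂ ≥ m R`).
* §2 THE THERMOMETER, kernel-checked: `riemannHypothesis_of_evenGroundEnergy_floor` — any floor
  `−σ_k ≤ ε_ev(a_k)` along SOME sequence of windows `a_k → ∞` with `σ_k → 0` is already the
  Riemann hypothesis (via the tree's `PolarPerronFrobenius.weilEvenGroundEnergy_le_neg_of_not_…`: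
  off RH the even ground energy is `≤ −η < 0` on all large windows); the same for `ε`
  (`riemannHypothesis_of_groundEnergy_floor`), and `riemannHypothesis_of_tendsto_weilEvenGroundEnergy`
  (the even-sector form of CCM25 Cor. 3.8, `lim ε = 0 ⇒ RH`).  The tree's
  `GroundStatesConvergeToXi.riemannHypothesis_iff_weilGroundEnergy_subexp` says more: ANY
  sub-exponential floor is EQUIVALENT to RH.  The floor the ratio route needs (§3) is
  `ε₁ ≥ −o(ε₂ − ε₁)`, i.e. of size `e^{−4πμ}·poly(μ)` (DATA, M2-DATA.md D1) — doubly exponentially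
  finer in `a` than a floor that is already RH.
* §3 the route at one window, over the Weil objects: `neg_weilGroundEnergy_le_of_m2Ratio` — if the
  M2 ratio of ANY vector `p` against a gap inequality of constant `δ` is `≤ θ < 1`, then
  `−ε(a) ≤ (θB + U)/(1 − θ)` where `B` is the Rayleigh quotient of any normalised window test
  orthogonal to `u` and `−U ≤ Re Q(p)`; hence (`riemannHypothesis_of_m2Ratio_tendsto_zero`) **an
  argument that drives the M2 ratio to `0` along a sequence of windows, with `B` fixed and
  `U_k → 0`, has proved RH before it concludes M2** — the ratio is a thermometer, not a mechanism
  that could run RH-free.  Conversely `m2_of_floor_of_gapDominance`: the floor `0 ≤ ε(a)` (RH-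
  strength) plus GAP DOMINANCE `m · Re Q(p) ≤ δ` give M2 at the window with defect `1/m`:
  `1 − |⟨p,u⟩|² ≤ 1/m`.  These two hypotheses, typed here as binders and nowhere asserted, are
  exactly "the lower-bound-on-ε₁ input that would close M2" and "the spectral-gap input"; the
  numbers `B, U, m` along `λ` are DATA in M2-DATA.md (ε₂/ε₁ ≈ 10^{2.7}μ^{4.4}, R(k̂)/ε₁ ≈ 1.2–1.6,
  so `m ≈ 10^{2.6}μ^{4.4}`, ratio ≈ 3·10⁻⁴μ⁻⁴, ‖u − k̂‖ ≈ 0.012·λ⁻⁴).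

References (bib keys of `lean/references.bib`): `ConnesConsaniMoscovici2025` (arXiv:2511.22755;
published `ConnesConsaniMoscovici2026`, doi:10.4171/elm/37/3) §3 Cor. 3.8, §§7–8;
`Connes2026Letter` (arXiv:2602.04022) §§6–7; `ConnesSuijlekom2025` (Comm. Math. Phys. 406 (2025)
312) Thm. 6.1; `Bombieri2000Weil` §4.
-/

noncomputable section

set_option linter.dupNamespace false  -- the mandated namespace repeats `RiemannHypothesis`

open Set MeasureTheory Filter Complex
open scoped Real Topology ComplexConjugate

namespace Summit.RiemannHypothesis.RiemannHypothesis.Theorems.PfPersistenceM2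

open Literature.NumberTheory.LFunctions

/-! ## §1 Real arithmetic of the M2 ratio `(R − ε₁)/(ε₂ − ε₁)` -/

/-- **Upper half + floor + gap ⇒ ratio bound.**  With `ε₁ ≤ R ≤ U` (variational principle and an
upper bound for the guess energy), a floor `−σ ≤ ε₁` and a gap `0 < G ≤ ε₂ − ε₁`:
`(R − ε₁)/(ε₂ − ε₁) ≤ (U + σ)/G`. [folklore] -/
theorem ratio_le_of_upper_floor_gap {ε₁ ε₂ R U σ G : ℝ} (hvar : ε₁ ≤ R) (hR : R ≤ U)
    (hfloor : -σ ≤ ε₁) (hG : G ≤ ε₂ - ε₁) (hGpos : 0 < G) :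
    (R - ε₁) / (ε₂ - ε₁) ≤ (U + σ) / G := by
  have hgap : 0 < ε₂ - ε₁ := hGpos.trans_le hG
  calc (R - ε₁) / (ε₂ - ε₁) ≤ (U + σ) / (ε₂ - ε₁) :=
        div_le_div_of_nonneg_right (by linarith) hgap.le
    _ ≤ (U + σ) / G := div_le_div_of_nonneg_left (by linarith) hGpos hG

/-- **A ratio bound forces a floor.**  If `R − ε₁ ≤ θ(ε₂ − ε₁)` with `0 ≤ θ < 1`, and a priori
`ε₂ ≤ B`, `−U ≤ R`, then `−ε₁ ≤ (θB + U)/(1 − θ)`.  (So "the M2 ratio is `≤ θ`" contains a lower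
bound on the ground energy.) [folklore] -/
theorem neg_le_of_ratio_le {ε₁ ε₂ R θ B U : ℝ} (hθ0 : 0 ≤ θ) (hθ1 : θ < 1)
    (hratio : R - ε₁ ≤ θ * (ε₂ - ε₁)) (hB : ε₂ ≤ B) (hU : -U ≤ R) :
    -ε₁ ≤ (θ * B + U) / (1 - θ) := by
  rw [le_div_iff₀ (by linarith)]
  have h1 : θ * ε₂ ≤ θ * B := mul_le_mul_of_nonneg_left hB hθ0
  nlinarith [h1, hratio, hU]

/-- The same with the ratio written as a quotient: `(R − ε₁)/(ε₂ − ε₁) ≤ θ`, `ε₁ < ε₂`.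
[folklore] -/
theorem neg_le_of_div_le {ε₁ ε₂ R θ B U : ℝ} (hθ0 : 0 ≤ θ) (hθ1 : θ < 1) (hgap : ε₁ < ε₂)
    (hratio : (R - ε₁) / (ε₂ - ε₁) ≤ θ) (hB : ε₂ ≤ B) (hU : -U ≤ R) :
    -ε₁ ≤ (θ * B + U) / (1 - θ) :=
  neg_le_of_ratio_le hθ0 hθ1 ((div_le_iff₀ (sub_pos.2 hgap)).1 hratio) hB hU

/-- **Under a non-negative floor the gap alone controls the ratio**: `0 ≤ ε₁ ≤ R < ε₂` gives
`(R − ε₁)/(ε₂ − ε₁) ≤ R/(ε₂ − R)`. [folklore] -/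
theorem ratio_le_of_nonneg_floor {ε₁ ε₂ R : ℝ} (h0 : 0 ≤ ε₁) (hvar : ε₁ ≤ R) (hlt : R < ε₂) :
    (R - ε₁) / (ε₂ - ε₁) ≤ R / (ε₂ - R) := by
  have h1 : 0 < ε₂ - R := sub_pos.2 hlt
  have h2 : 0 < ε₂ - ε₁ := by linarith
  rw [div_le_div_iff₀ h2 h1]
  nlinarith [sq_nonneg (R - ε₁), mul_nonneg h0 h2.le]

/-- **Gap dominance**: if moreover `m · R ≤ ε₂` with `1 < m` and `0 < R`, the ratio is `≤ 1/(m − 1)`.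
[folklore] -/
theorem ratio_le_inv_of_dominance {ε₁ ε₂ R m : ℝ} (h0 : 0 ≤ ε₁) (hvar : ε₁ ≤ R) (hR : 0 < R)
    (hm : 1 < m) (hdom : m * R ≤ ε₂) : (R - ε₁) / (ε₂ - ε₁) ≤ 1 / (m - 1) := by
  have hlt : R < ε₂ := by nlinarith
  refine (ratio_le_of_nonneg_floor h0 hvar hlt).trans ?_
  rw [div_le_div_iff₀ (sub_pos.2 hlt) (by linarith)]
  nlinarith

/-! ## §2 The thermometer: any vanishing floor on the ground energy along some windows is RH -/

/-- **Thermometer (even sector).**  If along some sequence of windows `a_k → ∞` the even ground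
energy obeys a floor `−σ_k ≤ ε_ev(a_k)` with `σ_k → 0`, the Riemann hypothesis holds: off RH,
`ε_ev(a) ≤ −η < 0` for all large `a` (tree, `PolarPerronFrobenius`). [folklore] -/
theorem riemannHypothesis_of_evenGroundEnergy_floor {a σ : ℕ → ℝ} (ha : Tendsto a atTop atTop)
    (hσ : Tendsto σ atTop (𝓝 0)) (h : ∀ᶠ k in atTop, -σ k ≤ weilEvenGroundEnergy (a k)) :
    RiemannHypothesis := by
  by_contra hRH
  obtain ⟨η, hη, A, hA⟩ :=
    PolarPerronFrobenius.weilEvenGroundEnergy_le_neg_of_not_riemannHypothesis hRH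
  have h1 : ∀ᶠ k in atTop, A ≤ a k := ha.eventually_ge_atTop A
  have h2 : ∀ᶠ k in atTop, σ k < η := hσ.eventually (Iio_mem_nhds hη)
  obtain ⟨k, hk, hk1, hk2⟩ := (h.and (h1.and h2)).exists
  have h3 := hA (a k) hk1
  linarith

/-- **Thermometer (full window).**  The same with `ε(a) = weilGroundEnergy a ≤ ε_ev(a)`. [folklore] -/
theorem riemannHypothesis_of_groundEnergy_floor {a σ : ℕ → ℝ} (ha : Tendsto a atTop atTop)
    (hσ : Tendsto σ atTop (𝓝 0)) (h : ∀ᶠ k in atTop, -σ k ≤ weilGroundEnergy (a k)) :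
    RiemannHypothesis :=
  riemannHypothesis_of_evenGroundEnergy_floor ha hσ
    (h.mono fun k hk ↦ hk.trans (weilGroundEnergy_le_weilEvenGroundEnergy (a k)))

/-- **`lim ε_ev = 0 ⇒ RH`** — the even-sector form of Connes–Consani–Moscovici, Cor. 3.8 (stated
there for the full bottom `μ_λ`; `ConnesConsaniMoscovici2025` = arXiv:2511.22755, published as
`ConnesConsaniMoscovici2026`). [cite: ConnesConsaniMoscovici2025, Cor. 3.8] -/
theorem riemannHypothesis_of_tendsto_weilEvenGroundEnergy
    (h : Tendsto weilEvenGroundEnergy atTop (𝓝 0)) : RiemannHypothesis := by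
  refine riemannHypothesis_of_evenGroundEnergy_floor (a := fun k : ℕ ↦ (k : ℝ))
    (σ := fun k : ℕ ↦ -weilEvenGroundEnergy k) tendsto_natCast_atTop_atTop ?_
    (Eventually.of_forall fun k ↦ by simp)
  simpa using (h.comp tendsto_natCast_atTop_atTop).neg

/-! ## §3 The ratio route at a window, over the Weil objects -/

/-- **The M2 ratio forces a floor on `ε(a)`.**  At a window `a`, suppose the variational gap
inequality with constant `δ` holds in the direction of `u` (the form PROVED from
`WeilWindowSimpleEven a` for ground states, `ConnesVanSuijlekom.gap_inequality`), let `g` be any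
normalised window test orthogonal to `u` with `Re Q(g) ≤ B` (so `δ ≤ B − ε(a)`), and let `p` be
ANY function whose M2 ratio is at most `θ`: `Re Q(p) − ε(a) ≤ θδ`, `0 ≤ θ < 1`, with
`−U ≤ Re Q(p)`.  Then `−ε(a) ≤ (θB + U)/(1 − θ)`. [folklore] -/
theorem neg_weilGroundEnergy_le_of_m2Ratio {a δ θ B U : ℝ} {u p g : ℝ → ℂ}
    (hgap : ∀ f : ℝ → ℂ, IsWeilTest f → tsupport f ⊆ Icc (-a) a →
      δ * ((∫ t, ‖f t‖ ^ 2) - ‖∫ t, f t * conj (u t)‖ ^ 2) ≤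
        (weilQuadratic f).re - weilGroundEnergy a * ∫ t, ‖f t‖ ^ 2)
    (hg : IsWeilTest g) (hgs : tsupport g ⊆ Icc (-a) a) (hg1 : ∫ t, ‖g t‖ ^ 2 = (1 : ℝ))
    (hgu : ∫ t, g t * conj (u t) = 0) (hgB : (weilQuadratic g).re ≤ B)
    (hθ0 : 0 ≤ θ) (hθ1 : θ < 1)
    (hratio : (weilQuadratic p).re - weilGroundEnergy a ≤ θ * δ)
    (hU : -U ≤ (weilQuadratic p).re) :
    -weilGroundEnergy a ≤ (θ * B + U) / (1 - θ) := by
  have hδ : δ ≤ B - weilGroundEnergy a := by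
    have h := hgap g hg hgs
    rw [hg1, hgu, norm_zero, mul_one] at h
    norm_num at h
    linarith
  refine neg_le_of_ratio_le (ε₂ := B) hθ0 hθ1 ?_ le_rfl hU
  exact hratio.trans (mul_le_mul_of_nonneg_left hδ hθ0)

/-- **The thermometer for the ratio route.**  Along windows `a_k → ∞`: gap inequalities with
constants `δ_k` in directions `u_k`, normalised window tests `g_k ⊥ u_k` of energy `≤ B` (ONE
constant — e.g. fixed tests living in a fixed sub-window), vectors `p_k` of energy `≥ −U_k` with
`U_k → 0`, and M2 ratios `≤ θ_k` with `θ_k → 0`.  Then the Riemann hypothesis holds — before, and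
independently of, any conclusion about the distance from `p_k` to `u_k`. [folklore] -/
theorem riemannHypothesis_of_m2Ratio_tendsto_zero {a δ θ U : ℕ → ℝ} {B : ℝ}
    {u p g : ℕ → ℝ → ℂ} (ha : Tendsto a atTop atTop)
    (hgap : ∀ k, ∀ f : ℝ → ℂ, IsWeilTest f → tsupport f ⊆ Icc (-(a k)) (a k) →
      δ k * ((∫ t, ‖f t‖ ^ 2) - ‖∫ t, f t * conj (u k t)‖ ^ 2) ≤
        (weilQuadratic f).re - weilGroundEnergy (a k) * ∫ t, ‖f t‖ ^ 2)
    (hg : ∀ k, IsWeilTest (g k)) (hgs : ∀ k, tsupport (g k) ⊆ Icc (-(a k)) (a k))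
    (hg1 : ∀ k, ∫ t, ‖g k t‖ ^ 2 = (1 : ℝ)) (hgu : ∀ k, ∫ t, g k t * conj (u k t) = 0)
    (hgB : ∀ k, (weilQuadratic (g k)).re ≤ B)
    (hθ0 : ∀ k, 0 ≤ θ k) (hθ : Tendsto θ atTop (𝓝 0))
    (hratio : ∀ k, (weilQuadratic (p k)).re - weilGroundEnergy (a k) ≤ θ k * δ k)
    (hU0 : ∀ k, -U k ≤ (weilQuadratic (p k)).re) (hU : Tendsto U atTop (𝓝 0)) :
    RiemannHypothesis := by
  refine riemannHypothesis_of_groundEnergy_floor (σ := fun k ↦ (θ k * B + U k) / (1 - θ k)) ha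
    ?_ ?_
  · have h1 : Tendsto (fun k ↦ θ k * B + U k) atTop (𝓝 (0 * B + 0)) := (hθ.mul_const B).add hU
    have h2 : Tendsto (fun k ↦ 1 - θ k) atTop (𝓝 (1 - 0)) := tendsto_const_nhds.sub hθ
    have h3 : Tendsto (fun k ↦ (θ k * B + U k) / (1 - θ k)) atTop (𝓝 ((0 * B + 0) / (1 - 0))) :=
      h1.div h2 (by norm_num)
    simpa using h3
  · filter_upwards [hθ.eventually (Iio_mem_nhds one_pos)] with k hk
    have h4 := neg_weilGroundEnergy_le_of_m2Ratio (hgap k) (hg k) (hgs k) (hg1 k) (hgu k) (hgB k)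
      (hθ0 k) hk (hratio k) (hU0 k)
    linarith

/-- **What closes M2 at a window, typed.**  The two inputs are binders, asserted nowhere:
(FLOOR) `0 ≤ ε(a)` — RH-strength: by `GroundStatesConvergeToXi.riemannHypothesis_iff_weilGroundEnergy_subexp`
already a sub-exponential floor on all windows is EQUIVALENT to RH; and (GAP DOMINANCE)
`m · Re Q(p) ≤ δ` — the gap constant above the ground state dominates the energy of the guess by a
factor `m`.  Conclusion: `1 − |⟨p, u⟩|² ≤ 1/m`, i.e. (for a ground state `u`,
`GroundStatesConvergeToXi.integral_norm_sq_quasimode_sub_proj_le`) `‖p − ⟨p,u⟩u‖₂² ≤ 1/m`. [folklore] -/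
theorem m2_of_floor_of_gapDominance {a δ m : ℝ} {u p : ℝ → ℂ}
    (hgap : ∀ f : ℝ → ℂ, IsWeilTest f → tsupport f ⊆ Icc (-a) a →
      δ * ((∫ t, ‖f t‖ ^ 2) - ‖∫ t, f t * conj (u t)‖ ^ 2) ≤
        (weilQuadratic f).re - weilGroundEnergy a * ∫ t, ‖f t‖ ^ 2)
    (hδ : 0 < δ) (hp : IsWeilTest p) (hps : tsupport p ⊆ Icc (-a) a)
    (hp1 : ∫ t, ‖p t‖ ^ 2 = (1 : ℝ))
    (hfloor : 0 ≤ weilGroundEnergy a) (hm : 0 < m) (hdom : m * (weilQuadratic p).re ≤ δ) :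
    1 - ‖∫ t, p t * conj (u t)‖ ^ 2 ≤ 1 / m := by
  refine GroundStatesConvergeToXi.one_sub_norm_sq_overlap_le_of_gap hgap hδ hp hps hp1 ?_
  have h1 : (weilQuadratic p).re ≤ δ / m := by
    rw [le_div_iff₀ hm, mul_comm]; exact hdom
  have h2 : δ / m = 1 / m * δ := by ring
  linarith

/-- **The floor needed is finer than RH** (bookkeeping form of the thermometer): if the ratio
route's inputs hold at EVERY window `a > 0` with a fixed `θ < 1`, fixed `B` and fixed `U` — far less
than M2 needs — the ground energy is bounded below uniformly, which is ALREADY the Riemann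
hypothesis (`GroundStatesConvergeToXi.riemannHypothesis_of_weilGroundEnergy_bddBelow`). [folklore] -/
theorem riemannHypothesis_of_m2Ratio_le_forall {θ B U : ℝ} {δ : ℝ → ℝ} {u p g : ℝ → ℝ → ℂ}
    (hθ0 : 0 ≤ θ) (hθ1 : θ < 1)
    (hgap : ∀ a, 0 < a → ∀ f : ℝ → ℂ, IsWeilTest f → tsupport f ⊆ Icc (-a) a →
      δ a * ((∫ t, ‖f t‖ ^ 2) - ‖∫ t, f t * conj (u a t)‖ ^ 2) ≤
        (weilQuadratic f).re - weilGroundEnergy a * ∫ t, ‖f t‖ ^ 2)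
    (hg : ∀ a, 0 < a → IsWeilTest (g a)) (hgs : ∀ a, 0 < a → tsupport (g a) ⊆ Icc (-a) a)
    (hg1 : ∀ a, 0 < a → ∫ t, ‖g a t‖ ^ 2 = (1 : ℝ))
    (hgu : ∀ a, 0 < a → ∫ t, g a t * conj (u a t) = 0)
    (hgB : ∀ a, 0 < a → (weilQuadratic (g a)).re ≤ B)
    (hratio : ∀ a, 0 < a → (weilQuadratic (p a)).re - weilGroundEnergy a ≤ θ * δ a)
    (hU : ∀ a, 0 < a → -U ≤ (weilQuadratic (p a)).re) : RiemannHypothesis :=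
  GroundStatesConvergeToXi.riemannHypothesis_of_weilGroundEnergy_bddBelow
    ⟨-((θ * B + U) / (1 - θ)), fun a ha ↦ by
      have := neg_weilGroundEnergy_le_of_m2Ratio (hgap a ha) (hg a ha) (hgs a ha) (hg1 a ha)
        (hgu a ha) (hgB a ha) hθ0 hθ1 (hratio a ha) (hU a ha)
      linarith⟩

end Summit.RiemannHypothesis.RiemannHypothesis.Theorems.PfPersistenceM2

end
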